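import Literature.Topology.FourManifolds.LatticeFormsNegTwoDVectorOrbitCount
import HarnessLib

/-!
# Split and non-split polarisation types: vectors of square `2d` with divisor `1` or `2` in
# `L_{2t} = 3U ⊕ 2E₈(−1) ⊕ ⟨−2t⟩` (Gritsenko–Hulek–Sankaran, *Moduli spaces of irreducible symplectic manifolds*,
# Compos. Math. 146 (2010), §4 of arXiv:0802.2078: Examples 4.8, 4.10, 4.11, Prop. 4.6 (iv) for `f ∈ {1, 2}`)

Trunk T-4MAN vocabulary; sequel of `LatticeFormsNegTwoVectorOrbits.lean` and `LatticeFormsNegTwoDVectorOrbitCount.lean`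
(rows g41-#1 ∕ #2: the abstract lattice `L = B₀ ⊕ ⟨−2t⟩` with `B₀` symmetric even unimodular containing two
orthogonal hyperbolic pairs; the `Õ`-orbit criterion `exists_stable_isometryEquiv_apply_eq_iff_dvd_snd_sub_snd` — for
vectors of equal square with `δ ∣ (·, L)` attained, `u ~ v ⟺ x_u ≡ x_v (mod δ)`; `exists_fst_eq_smul_of_forall_dvd`;
the transport chain for orthogonal complements). Written for lane `lit-hodgefound` (Track 2 foundations; prover
seat `lit-hodgefound-p18`, gen 41, row g41-#4). THEOREMS ONLY — no definition, no named fact, no instance, no notation.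

## Source, verbatim (V. Gritsenko, K. Hulek, G. K. Sankaran, Compos. Math. 146 (2010) 404–434, arXiv numbering §4,
held text `paper:arxiv-0802.2078` pp. 10–12)

"We consider the special lattice `L_{2t} = 3U ⊕ 2E₈(−1) ⊕ ⟨−2t⟩` […] We denote a generator of the `1`-dimensional
sublattice `⟨−2t⟩` by `l_t`, so `l_t² = −2t`, and we denote by `h_d` a primitive vector of length `2d`. Note that
`div(h_d)` is a common divisor of `2d` and `2t = −det(L_{2t})`. […] **Proposition 4.6.** Let `h_d ∈ L_{2t}` be
primitive of length `2d > 0` and `div(h_d) = f`. […] (iv) For `c` a suitable integer, determined mod `f` and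
satisfying `(c, f) = 1`, and `b = (d + c²t)/f²`, we have `(h_d)^⊥_{L_{2t}} ≅ 2U ⊕ 2E₈(−1) ⊕ B` with
`B = (−2b  c·2t/f ∕ c·2t/f  −2t)`. […] *Proof.* A primitive vector `h_d` with `(h_d, L_{2t}) = fℤ` can be written
`h_d = fv + cl_t` where `v ∈ 3U ⊕ 2E₈(−1)`. The coefficient `c` is coprime to `f` because `h_d` is primitive.
According to Eichler's criterion the `Õ(L_{2t})`-orbit of `h_d` is uniquely determined by `h_d* ≡ (c/f) l_t mod L_{2t}`.
Therefore it is determined by `c` mod `f` because the discriminant group of `L_{2t}` is cyclic. We put `v² = 2b`.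
Then `2d = 2bf² − 2c²t` […]
**Example 4.8.** Let `f = 1`. From the Proposition 4.6 it follows that for any `t` and `d` there is only one
`Õ(L_{2t})`-orbit of primitive vectors `h_d` with `div(h_d) = 1`. Moreover `c = 0` and so
`(h_d)^⊥_{L_{2t}} ≅ L_{2t,2d} = 2U ⊕ 2E₈(−1) ⊕ ⟨−2t⟩ ⊕ ⟨−2d⟩`.
**Definition 4.9.** We call a polarisation determined by a primitive vector `h_d` split if `div(h_d) = 1` and
non-split otherwise.
**Example 4.10.** Let `f = 2`. In this case `c` is odd, so we may take `c = 1`. A constant `b` and a vector `h_d` exist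
if and only if `d + t ≡ 0 mod 4`. Moreover the `Õ(L_{2t})`-orbit of `h_d` is unique because `D(L_{2t})` is cyclic and
thus contains only one element of order `2`. […]
**Example 4.11.** Let `d` and `t` be coprime. Examples 4.8 and 4.10 give us the full classification of possible
`h_d ∈ L_{2t}` (in particular if `t = 1` or `d = 1`), since if `(t, d) = 1` then `f = div(h_d) = 1` or `2`."

The case `t = 1` is GHS, Handbook of Moduli I (arXiv:1012.4155), §7 Example 7.7 (split ∕ non-split polarisations of
`K3^{[2]}`-type manifolds, `L_{K3,2} = 3U ⊕ 2E₈(−1) ⊕ ⟨−2⟩`, complements `L_{2,2d}` and `L_{Q(d)}`,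
`Q(d) = (−2 1 ∕ 1 −(d+1)/2)`, `d ≡ −1 mod 4`).

## Reading notes

* ABSTRACTION as in g41-#1 ∕ #2: `L = B₀ ⊕ ⟨−2t⟩` with `B₀` symmetric even unimodular containing two orthogonal
  hyperbolic pairs (`3U ⊕ 2E₈(−1)` is the printed `B₀`); `Õ` for the printed `Õ`; "`div(h) = f`" as `f ∣ (h, L)` with
  `(h, h') = f` attained; "primitive" as `h ≠ 0` with `ℤh` saturated. For `f = 1` primitivity is automatic; for
  `f = 2` it is a hypothesis (e.g. `2h₀` with `div(h₀) = 1` has `(2h₀, L) = 2ℤ` but an even `l_t`-coordinate).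
* `2d > 0` is not used: the statements hold for every `d ∈ ℤ`.
* The complements are computed in the models `(E₈(−1)^{⊕m} ⊕ U^{⊕(n+2)}) ⊕ ℤ(−2t)` (`L_{2t}`: `m = 2`, `n = 1`) in
  the bracketings `((E₈(−1)^{⊕m} ⊕ U^{⊕(n+1)}) ⊕ ⟨−2d⟩) ⊕ ⟨−2t⟩` (split) and `(E₈(−1)^{⊕m} ⊕ U^{⊕(n+1)}) ⊕ B`,
  `B = (−2b t ∕ t −2t)` with `4b = d + t` (non-split; GHS's `B` with `f = 2`, `c = 1`).
* The general `f` of Prop. 4.6 (i)–(iii) (orbit counts `w₊(f₁)φ(w₋(f₁))·2^{ρ(f₁)}`) is NOT here.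

## Contents (all proved)

* §1 split: `exists_apply_self_eq_two_mul_and_apply_eq_one` (`e + df`),
  **`exists_stable_isometryEquiv_apply_eq_of_apply_eq_one_of_apply_eq_one`** (one `Õ`-orbit),
  **`natCard_quot_stable_isometryEquiv_two_mul_of_apply_eq_one`** (`#orbits = 1`).
* §2 non-split: **`odd_snd_and_four_dvd_add_of_forall_two_dvd`** (primitive, `div = 2` ⟹ `c` odd and
  `d + t ≡ 0 (4)`), `exists_apply_self_eq_two_mul_and_forall_two_dvd_of_four_dvd` (`2(e + bf) + l_t`),
  **`exists_stable_isometryEquiv_apply_eq_of_forall_two_dvd_of_primitive`** (one `Õ`-orbit),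
  **`natCard_quot_stable_isometryEquiv_two_mul_of_forall_two_dvd_of_primitive`** (`#orbits = if 4 ∣ d + t then 1 else 0`).
* §3 `dvd_two_mul_of_forall_dvd_of_primitive` (`div(h) ∣ 2t`), **`exists_apply_eq_one_or_forall_two_dvd_of_isCoprime`**
  (Example 4.11: `(t, d) = 1 ⟹ div(h) ∈ {1, 2}`).
* §4 models: `forall_mem_span_singleton_apply_of_isometryEquiv` (primitivity along isometries), the orbit counts
  `natCard_quot_stable_isometryEquiv_model_two_mul_of_apply_eq_one ∕ _of_forall_two_dvd_of_primitive`, the rank-`2`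
  computation `restrict_orthogonal_hyperbolicForm_prod_neg_twoMul_smul_mul_equivalent'` (`B`), and the complements
  **`restrict_orthogonal_model_equivalent_of_apply_eq_one`** (`≅ … ⊕ ⟨−2d⟩ ⊕ ⟨−2t⟩`) and
  **`restrict_orthogonal_model_equivalent_of_forall_two_dvd_of_primitive`** (`≅ … ⊕ B`).

## References

* [GritsenkoHulekSankaran2010Symplectic] V. Gritsenko, K. Hulek, G. K. Sankaran, Moduli spaces of irreducible
  symplectic manifolds, Compos. Math. 146 (2010) 404–434 (arXiv:0802.2078): §4 Prop. 4.6 (iv), Examples 4.8, 4.10,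
  4.11, Definition 4.9.
* [GritsenkoHulekSankaran2013ModuliK3] V. Gritsenko, K. Hulek, G. K. Sankaran, Moduli of K3 surfaces and irreducible
  symplectic manifolds, Handbook of Moduli I (2013): §7 Example 7.7, Remark 7.8.
* [GritsenkoHulekSankaran2009] V. Gritsenko, K. Hulek, G. K. Sankaran, Abelianisation of orthogonal groups and the
  fundamental group of modular varieties, J. Algebra 322 (2009): Prop. 3.3 (i) (Eichler criterion).
-/

noncomputable section

open Module Function
open LinearMap (BilinForm)
open LinearMap.BilinForm

namespace Literature.Topology.FourManifolds

universe u

/-! ### §1 Split polarisations: `div(h) = 1` -/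

section Split

variable {M : Type u} [AddCommGroup M] {B₀ : BilinForm ℤ M} (t : ℕ)

/-- **Existence of split vectors**: `h = e + df` has `h² = 2d` and the dual vector `f` (`(h, f) = 1`), in any
`B₀ ⊕ ⟨−2t⟩` whose `B₀` contains a hyperbolic plane. [cite: GritsenkoHulekSankaran2010Symplectic, §4 (arXiv numbering) Example 4.8 ("for any `t` and `d` there is only one `Õ(L_{2t})`-orbit of primitive vectors `h_d` with `div(h_d) = 1`")] -/
theorem exists_apply_self_eq_two_mul_and_apply_eq_one {x y x₁ y₁ : M} (h : TwoHyperbolicPairs B₀ x y x₁ y₁) (d : ℤ) :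
    ∃ r r' : M × ℤ, B₀.prod ((-(2 * t : ℤ)) • LinearMap.mul ℤ ℤ) r r = 2 * d ∧
      B₀.prod ((-(2 * t : ℤ)) • LinearMap.mul ℤ ℤ) r r' = 1 := by
  refine ⟨(x + d • y, 0), (y, 0), ?_, ?_⟩
  · rw [prod_neg_twoMul_smul_mul_apply]
    dsimp only
    simp only [map_add, map_zsmul, LinearMap.add_apply, LinearMap.smul_apply, smul_eq_mul, h.xx, h.yy, h.xy,
      h.isSymm.eq y x]
    ring
  · rw [prod_neg_twoMul_smul_mul_apply]
    dsimp only
    simp only [map_add, map_zsmul, LinearMap.add_apply, LinearMap.smul_apply, smul_eq_mul, h.yy, h.xy]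
    ring

variable [Module.Finite ℤ M] [Module.Free ℤ M]

/-- **Example 4.8, the orbit: vectors of the same square with `div = 1` form ONE `Õ(B₀ ⊕ ⟨−2t⟩)`-orbit** (`B₀` even
unimodular with two orthogonal hyperbolic pairs, `t ≥ 1`): "for any `t` and `d` there is only one `Õ(L_{2t})`-orbit of
primitive vectors `h_d` with `div(h_d) = 1`" — Eichler's criterion with `h* = h ∈ L`.
[cite: GritsenkoHulekSankaran2010Symplectic, §4 (arXiv numbering) Example 4.8] [cite: GritsenkoHulekSankaran2009, Prop. 3.3 (i)] -/
theorem exists_stable_isometryEquiv_apply_eq_of_apply_eq_one_of_apply_eq_one (hu : B₀.IsUnimodular)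
    (he : B₀.IsEven) (ht : 0 < t) {x y x₁ y₁ : M} (h : TwoHyperbolicPairs B₀ x y x₁ y₁) {u v u' v' : M × ℤ}
    (huv : B₀.prod ((-(2 * t : ℤ)) • LinearMap.mul ℤ ℤ) u u = B₀.prod ((-(2 * t : ℤ)) • LinearMap.mul ℤ ℤ) v v)
    (hu' : B₀.prod ((-(2 * t : ℤ)) • LinearMap.mul ℤ ℤ) u u' = 1)
    (hv' : B₀.prod ((-(2 * t : ℤ)) • LinearMap.mul ℤ ℤ) v v' = 1) :
    ∃ g : (B₀.prod ((-(2 * t : ℤ)) • LinearMap.mul ℤ ℤ)).IsometryEquiv (B₀.prod ((-(2 * t : ℤ)) • LinearMap.mul ℤ ℤ)),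
      g.discriminantGroupCongr = LinearEquiv.refl ℤ _ ∧ g u = v :=
  (exists_stable_isometryEquiv_apply_eq_iff_dvd_snd_sub_snd t hu he ht h one_ne_zero huv (fun _ ↦ one_dvd _)
    (fun _ ↦ one_dvd _) hu' hv').2 (one_dvd _)

/-- **Example 4.8 as a count: the vectors of square `2d` with `div = 1` form exactly one `Õ(B₀ ⊕ ⟨−2t⟩)`-orbit**
(for every `d ∈ ℤ`, `t ≥ 1`). [cite: GritsenkoHulekSankaran2010Symplectic, §4 (arXiv numbering) Example 4.8, Definition 4.9 ("split if `div(h_d) = 1`")] -/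
theorem natCard_quot_stable_isometryEquiv_two_mul_of_apply_eq_one (hu : B₀.IsUnimodular) (he : B₀.IsEven)
    (ht : 0 < t) {x y x₁ y₁ : M} (h : TwoHyperbolicPairs B₀ x y x₁ y₁) (d : ℤ) :
    Nat.card (Quot fun r s : {r : M × ℤ // B₀.prod ((-(2 * t : ℤ)) • LinearMap.mul ℤ ℤ) r r = 2 * d ∧
        ∃ r', B₀.prod ((-(2 * t : ℤ)) • LinearMap.mul ℤ ℤ) r r' = 1} ↦
      ∃ g : (B₀.prod ((-(2 * t : ℤ)) • LinearMap.mul ℤ ℤ)).IsometryEquiv (B₀.prod ((-(2 * t : ℤ)) • LinearMap.mul ℤ ℤ)),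
        g.discriminantGroupCongr = LinearEquiv.refl ℤ _ ∧ g r.1 = s.1) = 1 := by
  obtain ⟨r₀, r₀', hr₀, hr₀'⟩ := exists_apply_self_eq_two_mul_and_apply_eq_one t h d
  rw [Nat.card_eq_one_iff_unique]
  refine ⟨⟨?_⟩, ⟨Quot.mk _ ⟨r₀, hr₀, r₀', hr₀'⟩⟩⟩
  rintro ⟨⟨r, hr, r', hr'⟩⟩ ⟨⟨s, hs, s', hs'⟩⟩
  exact Quot.sound (exists_stable_isometryEquiv_apply_eq_of_apply_eq_one_of_apply_eq_one t hu he ht h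
    (hr.trans hs.symm) hr' hs')

end Split

/-! ### §2 Non-split polarisations with `div(h) = 2` -/

section NonSplit

variable {M : Type u} [AddCommGroup M] {B₀ : BilinForm ℤ M} (t : ℕ)

/-- **"`h_d = fv + cl_t` … the coefficient `c` is coprime to `f` because `h_d` is primitive", `f = 2`: "In this case
`c` is odd"; and then "a constant `b` and a vector `h_d` exist if and only if `d + t ≡ 0 mod 4`", necessity** — for a
primitive `h ∈ B₀ ⊕ ⟨−2t⟩` (`B₀` even unimodular) with `h² = 2d` and all products even: `h = 2v + c l_t` with `c` odd
and `4 ∣ d + t` (`8b − 2tc² = 2d`, `v² = 2b`). [cite: GritsenkoHulekSankaran2010Symplectic, §4 (arXiv numbering) Example 4.10 and proof of Prop. 4.6] -/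
theorem odd_snd_and_four_dvd_add_of_forall_two_dvd [Module.IsTorsionFree ℤ M] (hu : B₀.IsUnimodular)
    (he : B₀.IsEven) {r : M × ℤ} {d : ℤ} (hr : B₀.prod ((-(2 * t : ℤ)) • LinearMap.mul ℤ ℤ) r r = 2 * d)
    (hr0 : r ≠ 0) (hsat : ∀ (k : ℤ) (w : M × ℤ), k ≠ 0 → k • w ∈ ℤ ∙ r → w ∈ ℤ ∙ r)
    (h2 : ∀ z, (2 : ℤ) ∣ B₀.prod ((-(2 * t : ℤ)) • LinearMap.mul ℤ ℤ) r z) : Odd r.2 ∧ (4 : ℤ) ∣ d + t := by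
  obtain ⟨v, hv⟩ := exists_fst_eq_smul_of_forall_dvd t hu h2
  -- `c` is odd: otherwise `r = 2 (v, c/2)` is not primitive
  have hodd : Odd r.2 := by
    refine Int.not_even_iff_odd.1 ?_
    rintro ⟨j, hj⟩
    have hmem : (v, j) ∈ ℤ ∙ r := hsat 2 (v, j) two_ne_zero <| by
      have h1 : (2 : ℤ) • (v, j) = r := Prod.ext (by simpa using hv.symm) (by change (2 : ℤ) * j = r.2; omega)
      rw [h1]
      exact Submodule.mem_span_singleton_self r
    obtain ⟨a, ha⟩ := Submodule.mem_span_singleton.1 hmem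
    have h3 : (2 * a - 1) • r = 0 := by
      rw [sub_smul, mul_smul, ha, one_smul, sub_eq_zero]
      exact Prod.ext (by simpa using hv.symm) (by change (2 : ℤ) * j = r.2; omega)
    rcases smul_eq_zero.1 h3 with h4 | h4
    · omega
    · exact hr0 h4
  refine ⟨hodd, ?_⟩
  obtain ⟨j, hj⟩ := hodd
  obtain ⟨b, hb⟩ := he v
  rw [prod_neg_twoMul_smul_mul_apply, hv, map_zsmul, map_zsmul, LinearMap.smul_apply, smul_eq_mul, smul_eq_mul,
    hb, hj] at hr
  exact ⟨b - t * (j * j + j), by linarith⟩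

/-- **Example 4.10, existence: if `d + t ≡ 0 mod 4`, `d + t = 4b`, then `h = 2(e + bf) + l_t` is primitive with
`h² = 2d`, `(h, f) = 2` and all products even** ("we may take `c = 1`").
[cite: GritsenkoHulekSankaran2010Symplectic, §4 (arXiv numbering) Example 4.10] -/
theorem exists_apply_self_eq_two_mul_and_forall_two_dvd_of_four_dvd [Module.IsTorsionFree ℤ M] {x y x₁ y₁ : M}
    (h : TwoHyperbolicPairs B₀ x y x₁ y₁) {d b : ℤ} (hb : d + t = 4 * b) :
    ∃ r r' : M × ℤ, r.2 = 1 ∧ B₀.prod ((-(2 * t : ℤ)) • LinearMap.mul ℤ ℤ) r r = 2 * d ∧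
      B₀.prod ((-(2 * t : ℤ)) • LinearMap.mul ℤ ℤ) r r' = 2 ∧
        (∀ z, (2 : ℤ) ∣ B₀.prod ((-(2 * t : ℤ)) • LinearMap.mul ℤ ℤ) r z) ∧
          ∀ (k : ℤ) (w : M × ℤ), k ≠ 0 → k • w ∈ ℤ ∙ r → w ∈ ℤ ∙ r := by
  refine ⟨((2 : ℤ) • (x + b • y), 1), (y, 0), rfl, ?_, ?_, fun z ↦ ?_, fun k w hk hw ↦ ?_⟩
  · rw [prod_neg_twoMul_smul_mul_apply]
    dsimp only
    simp only [map_add, map_zsmul, LinearMap.add_apply, LinearMap.smul_apply, smul_eq_mul, h.xx, h.yy, h.xy,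
      h.isSymm.eq y x]
    linarith
  · rw [prod_neg_twoMul_smul_mul_apply]
    dsimp only
    simp only [map_add, map_zsmul, LinearMap.add_apply, LinearMap.smul_apply, smul_eq_mul, h.yy, h.xy]
    ring
  · rw [prod_neg_twoMul_smul_mul_apply]
    dsimp only
    simp only [map_add, map_zsmul, LinearMap.add_apply, LinearMap.smul_apply, smul_eq_mul]
    exact ⟨B₀ x z.1 + b * B₀ y z.1 - t * z.2, by ring⟩
  · -- primitivity: the `l_t`-coordinate of `h` is `1`
    obtain ⟨a, ha⟩ := Submodule.mem_span_singleton.1 hw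
    have h2 : a = k * w.2 := by
      have := congrArg Prod.snd ha
      simp only [Prod.smul_snd, smul_eq_mul, mul_one] at this
      exact this
    refine Submodule.mem_span_singleton.2 ⟨w.2, ?_⟩
    have h3 : k • (w.2 • ((2 : ℤ) • (x + b • y), (1 : ℤ)) - w) = 0 := by
      rw [smul_sub, smul_smul, ← h2, ha, sub_self]
    rw [smul_eq_zero_iff_right hk, sub_eq_zero] at h3
    exact h3

variable [Module.Finite ℤ M] [Module.Free ℤ M]

/-- **Example 4.10, the orbit: "the `Õ(L_{2t})`-orbit of `h_d` is unique because `D(L_{2t})` is cyclic and thus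
contains only one element of order `2`"** — two primitive vectors of the same square with `(h, L) = 2ℤ` lie in one
`Õ(B₀ ⊕ ⟨−2t⟩)`-orbit (their `l_t`-coordinates are both odd, so `h ≡ h' mod 2L`; Eichler).
[cite: GritsenkoHulekSankaran2010Symplectic, §4 (arXiv numbering) Example 4.10] [cite: GritsenkoHulekSankaran2009, Prop. 3.3 (i)] -/
theorem exists_stable_isometryEquiv_apply_eq_of_forall_two_dvd_of_primitive (hu : B₀.IsUnimodular)
    (he : B₀.IsEven) (ht : 0 < t) {x y x₁ y₁ : M} (h : TwoHyperbolicPairs B₀ x y x₁ y₁) {u v u' v' : M × ℤ}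
    {d : ℤ} (huu : B₀.prod ((-(2 * t : ℤ)) • LinearMap.mul ℤ ℤ) u u = 2 * d)
    (hvv : B₀.prod ((-(2 * t : ℤ)) • LinearMap.mul ℤ ℤ) v v = 2 * d)
    (hu0 : u ≠ 0) (husat : ∀ (k : ℤ) (w : M × ℤ), k ≠ 0 → k • w ∈ ℤ ∙ u → w ∈ ℤ ∙ u)
    (hv0 : v ≠ 0) (hvsat : ∀ (k : ℤ) (w : M × ℤ), k ≠ 0 → k • w ∈ ℤ ∙ v → w ∈ ℤ ∙ v)
    (h2u : ∀ z, (2 : ℤ) ∣ B₀.prod ((-(2 * t : ℤ)) • LinearMap.mul ℤ ℤ) u z)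
    (h2v : ∀ z, (2 : ℤ) ∣ B₀.prod ((-(2 * t : ℤ)) • LinearMap.mul ℤ ℤ) v z)
    (hu' : B₀.prod ((-(2 * t : ℤ)) • LinearMap.mul ℤ ℤ) u u' = 2)
    (hv' : B₀.prod ((-(2 * t : ℤ)) • LinearMap.mul ℤ ℤ) v v' = 2) :
    ∃ g : (B₀.prod ((-(2 * t : ℤ)) • LinearMap.mul ℤ ℤ)).IsometryEquiv (B₀.prod ((-(2 * t : ℤ)) • LinearMap.mul ℤ ℤ)),
      g.discriminantGroupCongr = LinearEquiv.refl ℤ _ ∧ g u = v := by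
  haveI : Module.IsTorsionFree ℤ M := inferInstance
  obtain ⟨⟨a, ha⟩, -⟩ := odd_snd_and_four_dvd_add_of_forall_two_dvd t hu he huu hu0 husat h2u
  obtain ⟨⟨b, hb⟩, -⟩ := odd_snd_and_four_dvd_add_of_forall_two_dvd t hu he hvv hv0 hvsat h2v
  exact (exists_stable_isometryEquiv_apply_eq_iff_dvd_snd_sub_snd t hu he ht h two_ne_zero (huu.trans hvv.symm)
    h2u h2v hu' hv').2 ⟨a - b, by rw [ha, hb]; ring⟩

/-- **Example 4.10 as a count: the primitive vectors of square `2d` with `(h, L) = 2ℤ` form ONE `Õ(B₀ ⊕ ⟨−2t⟩)`-orbit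
if `d + t ≡ 0 (mod 4)` and do not exist otherwise.** [cite: GritsenkoHulekSankaran2010Symplectic, §4 (arXiv numbering) Example 4.10 ("A constant `b` and a vector `h_d` exist if and only if `d + t ≡ 0 mod 4`. Moreover the `Õ(L_{2t})`-orbit of `h_d` is unique")] -/
theorem natCard_quot_stable_isometryEquiv_two_mul_of_forall_two_dvd_of_primitive (hu : B₀.IsUnimodular)
    (he : B₀.IsEven) (ht : 0 < t) {x y x₁ y₁ : M} (h : TwoHyperbolicPairs B₀ x y x₁ y₁) (d : ℤ) :
    Nat.card (Quot fun r s : {r : M × ℤ // B₀.prod ((-(2 * t : ℤ)) • LinearMap.mul ℤ ℤ) r r = 2 * d ∧ r ≠ 0 ∧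
        (∀ (k : ℤ) (w : M × ℤ), k ≠ 0 → k • w ∈ ℤ ∙ r → w ∈ ℤ ∙ r) ∧
        (∀ z, (2 : ℤ) ∣ B₀.prod ((-(2 * t : ℤ)) • LinearMap.mul ℤ ℤ) r z) ∧
        ∃ r', B₀.prod ((-(2 * t : ℤ)) • LinearMap.mul ℤ ℤ) r r' = 2} ↦
      ∃ g : (B₀.prod ((-(2 * t : ℤ)) • LinearMap.mul ℤ ℤ)).IsometryEquiv (B₀.prod ((-(2 * t : ℤ)) • LinearMap.mul ℤ ℤ)),
        g.discriminantGroupCongr = LinearEquiv.refl ℤ _ ∧ g r.1 = s.1) = if (4 : ℤ) ∣ d + t then 1 else 0 := by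
  haveI : Module.IsTorsionFree ℤ M := inferInstance
  split_ifs with h4
  · obtain ⟨b, hb⟩ := h4
    obtain ⟨r₀, r₀', hr₀1, hr₀, hr₀', h2r₀, hr₀sat⟩ :=
      exists_apply_self_eq_two_mul_and_forall_two_dvd_of_four_dvd t h (d := d) (b := b) hb
    have hr₀0 : r₀ ≠ 0 := by
      rintro rfl
      simp at hr₀1
    rw [Nat.card_eq_one_iff_unique]
    refine ⟨⟨?_⟩, ⟨Quot.mk _ ⟨r₀, hr₀, hr₀0, hr₀sat, h2r₀, r₀', hr₀'⟩⟩⟩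
    rintro ⟨⟨r, hr, hr0, hrsat, h2r, r', hr'⟩⟩ ⟨⟨s, hs, hs0, hssat, h2s, s', hs'⟩⟩
    exact Quot.sound (exists_stable_isometryEquiv_apply_eq_of_forall_two_dvd_of_primitive t hu he ht h hr hs hr0
      hrsat hs0 hssat h2r h2s hr' hs')
  · rw [Nat.card_eq_zero]
    left
    refine ⟨?_⟩
    rintro ⟨⟨r, hr, hr0, hrsat, h2r, -⟩⟩
    exact h4 (odd_snd_and_four_dvd_add_of_forall_two_dvd t hu he hr hr0 hrsat h2r).2

end NonSplit

/-! ### §3 "if `(t, d) = 1` then `f = div(h_d) = 1` or `2`" -/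

section Coprime

variable {M : Type u} [AddCommGroup M] [Module.IsTorsionFree ℤ M] {B₀ : BilinForm ℤ M} (t : ℕ)

/-- **"`div(h_d)` is a common divisor of `2d` and `2t = −det(L_{2t})`"**: if `h ∈ B₀ ⊕ ⟨−2t⟩` (`B₀` unimodular) is
primitive and `δ` divides all products `(h, z)`, then `δ ∣ 2t` — `h = δv + c l_t` with `gcd(δ, c) = 1` by primitivity
and `δ ∣ (h, l_t) = −2tc`. [cite: GritsenkoHulekSankaran2010Symplectic, §4 (arXiv numbering) before Prop. 4.6 ("Note that `div(h_d)` is a common divisor of `2d` and `2t = −det(L_{2t})`") and proof of Prop. 4.6 ("The coefficient `c` is coprime to `f` because `h_d` is primitive")] -/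
theorem dvd_two_mul_of_forall_dvd_of_primitive (hu : B₀.IsUnimodular) {r : M × ℤ} {δ : ℤ} (hr0 : r ≠ 0)
    (hsat : ∀ (k : ℤ) (w : M × ℤ), k ≠ 0 → k • w ∈ ℤ ∙ r → w ∈ ℤ ∙ r)
    (hδ : ∀ z, δ ∣ B₀.prod ((-(2 * t : ℤ)) • LinearMap.mul ℤ ℤ) r z) : δ ∣ 2 * t := by
  obtain ⟨v, hv⟩ := exists_fst_eq_smul_of_forall_dvd t hu hδ
  -- `gcd(δ, c) = 1`
  have hg : Int.gcd δ r.2 = 1 := by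
    set g := Int.gcd δ r.2 with hgdef
    obtain ⟨δ', hδ'⟩ := Int.gcd_dvd_left δ r.2
    obtain ⟨c', hc'⟩ := Int.gcd_dvd_right δ r.2
    have hg0 : (g : ℤ) ≠ 0 := by
      intro h0
      have : δ = 0 := by rw [hδ', ← hgdef, h0, zero_mul]
      subst this
      -- all products vanish: `r` is in the radical of a nondegenerate lattice… simpler: `(r, z) = 0` for all `z`
      -- contradicts primitivity only indirectly; use instead `r.1 = 0 • v = 0` and `g = gcd 0 c = |c|`, so `c = 0`
      have hc0 : r.2 = 0 := by
        have : (Int.gcd 0 r.2 : ℤ) = 0 := by rw [hgdef] at h0; exact h0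
        simpa [Int.gcd_zero_left] using this
      exact hr0 (Prod.ext (by rw [hv, zero_smul]; rfl) hc0)
    have hmem : (δ' • v, c') ∈ ℤ ∙ r := hsat g (δ' • v, c') hg0 <| by
      have h1 : (g : ℤ) • (δ' • v, c') = r :=
        Prod.ext (by change (g : ℤ) • δ' • v = r.1; rw [smul_smul, ← hδ', hv]) (by change (g : ℤ) * c' = r.2; rw [← hc'])
      rw [h1]
      exact Submodule.mem_span_singleton_self r
    obtain ⟨a, ha⟩ := Submodule.mem_span_singleton.1 hmem
    have h3 : ((g : ℤ) * a - 1) • r = 0 := by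
      rw [sub_smul, mul_smul, ha, one_smul, sub_eq_zero]
      exact Prod.ext (by change (g : ℤ) • δ' • v = r.1; rw [smul_smul, ← hδ', hv])
        (by change (g : ℤ) * c' = r.2; rw [← hc'])
    rcases smul_eq_zero.1 h3 with h4 | h4
    · have h5 : (g : ℤ) * a = 1 := by linarith
      have h6 := Int.eq_one_of_mul_eq_one_right (by positivity) h5
      exact_mod_cast h6
    · exact absurd h4 hr0
  -- `δ ∣ (h, l_t) = −2tc`
  have h1 := hδ (0, 1)
  rw [prod_neg_twoMul_smul_mul_apply, map_zero, mul_one, zero_sub, dvd_neg] at h1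
  exact Int.dvd_of_dvd_mul_left_of_gcd_one h1 hg

/-- **Example 4.11: "if `(t, d) = 1` then `f = div(h_d) = 1` or `2`"** — a primitive `h ∈ B₀ ⊕ ⟨−2t⟩` with `h² = 2d`,
`gcd(t, d) = 1`, has `(h, L) = ℤ` or `(h, L) = 2ℤ`. [cite: GritsenkoHulekSankaran2010Symplectic, §4 (arXiv numbering) Example 4.11] -/
theorem exists_apply_eq_one_or_forall_two_dvd_of_isCoprime (hu : B₀.IsUnimodular) {r : M × ℤ} {d : ℤ}
    (hr : B₀.prod ((-(2 * t : ℤ)) • LinearMap.mul ℤ ℤ) r r = 2 * d) (hr0 : r ≠ 0)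
    (hsat : ∀ (k : ℤ) (w : M × ℤ), k ≠ 0 → k • w ∈ ℤ ∙ r → w ∈ ℤ ∙ r) (htd : Int.gcd t d = 1) :
    (∃ r', B₀.prod ((-(2 * t : ℤ)) • LinearMap.mul ℤ ℤ) r r' = 1) ∨
      ((∀ z, (2 : ℤ) ∣ B₀.prod ((-(2 * t : ℤ)) • LinearMap.mul ℤ ℤ) r z) ∧
        ∃ r', B₀.prod ((-(2 * t : ℤ)) • LinearMap.mul ℤ ℤ) r r' = 2) := by
  obtain ⟨δ, r', hδ, hr'⟩ := exists_divisor_generator (B₀.prod ((-(2 * t : ℤ)) • LinearMap.mul ℤ ℤ)) r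
  have h2t : δ ∣ 2 * t := dvd_two_mul_of_forall_dvd_of_primitive t hu hr0 hsat hδ
  have h2d : δ ∣ 2 * d := hr ▸ hδ r
  have h2 : δ ∣ 2 := by
    have h3 : δ ∣ Int.gcd (2 * t) (2 * d) := Int.dvd_coe_gcd h2t h2d
    rwa [Int.gcd_mul_left, htd, mul_one] at h3
  -- `δ ∈ {±1, ±2}`
  have hδ0 : δ ≠ 0 := by rintro rfl; simp at h2
  have hle : δ.natAbs ≤ 2 := Nat.le_of_dvd two_pos (Int.natAbs_dvd_natAbs.2 h2)
  have hcases : δ = 1 ∨ δ = -1 ∨ δ = 2 ∨ δ = -2 := by omega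
  rcases hcases with rfl | rfl | rfl | rfl
  · exact Or.inl ⟨r', hr'⟩
  · exact Or.inl ⟨-r', by rw [map_neg, hr']; norm_num⟩
  · exact Or.inr ⟨hδ, r', hr'⟩
  · exact Or.inr ⟨fun z ↦ (neg_dvd.1 (hδ z) : _), -r', by rw [map_neg, hr']; norm_num⟩

end Coprime

/-! ### §4 The models `(E₈(−1)^{⊕m} ⊕ U^{⊕(n+2)}) ⊕ ℤ(−2t)` (`L_{2t}`: `m = 2`, `n = 1`): orbits and complements -/

section Transport

variable {V V' : Type*} [AddCommGroup V] [AddCommGroup V'] {Q : BilinForm ℤ V} {Q' : BilinForm ℤ V'}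

/-- Primitivity (`ℤr` saturated) is transported along an isometry. [cite: GritsenkoHulekSankaran2010Symplectic, §4 (arXiv numbering) proof of Prop. 4.6 ("`h_d` is primitive")] -/
theorem forall_mem_span_singleton_apply_of_isometryEquiv (e : Q.IsometryEquiv Q') {r : V}
    (hsat : ∀ (k : ℤ) (w : V), k ≠ 0 → k • w ∈ ℤ ∙ r → w ∈ ℤ ∙ r) :
    ∀ (k : ℤ) (w : V'), k ≠ 0 → k • w ∈ ℤ ∙ e r → w ∈ ℤ ∙ e r := by
  intro k w hk hw
  obtain ⟨a, ha⟩ := Submodule.mem_span_singleton.1 hw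
  have h1 : k • e.symm w ∈ ℤ ∙ r := Submodule.mem_span_singleton.2 ⟨a, e.toLinearEquiv.injective <| by
    change e (a • r) = e (k • e.symm w)
    rw [map_zsmul, map_zsmul, ha]
    exact congrArg (k • ·) (e.toLinearEquiv.apply_symm_apply w).symm⟩
  obtain ⟨c, hc⟩ := Submodule.mem_span_singleton.1 (hsat k _ hk h1)
  refine Submodule.mem_span_singleton.2 ⟨c, ?_⟩
  rw [← map_zsmul, hc]
  exact e.toLinearEquiv.apply_symm_apply w

end Transport

section Model

variable (m n t : ℕ)

/-- `E₈(−1)^{⊕m} ⊕ U^{⊕k}` is symmetric, even and unimodular. [cite: GritsenkoHulekSankaran2010Symplectic, §4 (arXiv numbering) ("`L_{2t} = 3U ⊕ 2E₈(−1) ⊕ ⟨−2t⟩`")] -/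
theorem isSymm_isEven_isUnimodular_pi_neg_e8Form_prod_hyperbolicSum' (k : ℕ) :
    ((LinearMap.BilinForm.pi fun _ : Fin m ↦ -e8Form).prod (hyperbolicSum k)).IsSymm ∧
      ((LinearMap.BilinForm.pi fun _ : Fin m ↦ -e8Form).prod (hyperbolicSum k)).IsEven ∧
        ((LinearMap.BilinForm.pi fun _ : Fin m ↦ -e8Form).prod (hyperbolicSum k)).IsUnimodular := by
  obtain ⟨hsP, heP, huP⟩ := isSymm_isEven_isUnimodular_pi_neg_e8Form (m := m)
  exact ⟨hsP.prod (isSymm_hyperbolicSum k), isEven_prod_iff.2 ⟨heP, isEven_hyperbolicSum k⟩,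
    isUnimodular_prod_iff.2 ⟨huP, isUnimodular_hyperbolicSum k⟩⟩

/-- The two hyperbolic planes `(e₁, f₁), (e₂, f₂)` of `E₈(−1)^{⊕m} ⊕ U^{⊕(n+2)}`.
[cite: GritsenkoHulekSankaran2010Symplectic, §4 (arXiv numbering) Lemma 4.5 ("Let `L` be a lattice containing two orthogonal isotropic planes")] -/
theorem twoHyperbolicPairs_pi_neg_e8Form_prod_hyperbolicSum_add_two :
    TwoHyperbolicPairs ((LinearMap.BilinForm.pi fun _ : Fin m ↦ -e8Form).prod (hyperbolicSum (n + 2)))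
      (0, (Pi.single 0 1, 0)) (0, (0, Pi.single 0 1)) (0, (Pi.single 1 1, 0)) (0, (0, Pi.single 1 1)) :=
  TwoHyperbolicPairs.inr (IsSymm.pi fun _ ↦ isSymm_e8Form.neg)
    (twoHyperbolicPairs_hyperbolicSum (Fin.zero_ne_one (n := n)))

/-- **Example 4.8 for the models: one `Õ`-orbit of vectors of square `2d` with `div = 1`** in
`(E₈(−1)^{⊕m} ⊕ U^{⊕(n+2)}) ⊕ ℤ(−2t)` (`t ≥ 1`; `L_{2t}` is `m = 2`, `n = 1`).
[cite: GritsenkoHulekSankaran2010Symplectic, §4 (arXiv numbering) Example 4.8] -/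
theorem natCard_quot_stable_isometryEquiv_model_two_mul_of_apply_eq_one (ht : 0 < t) (d : ℤ) :
    Nat.card (Quot fun r s : {r : ((Fin m → Fin 8 → ℤ) × ((Fin (n + 2) → ℤ) × (Fin (n + 2) → ℤ))) × ℤ //
        (((LinearMap.BilinForm.pi fun _ : Fin m ↦ -e8Form).prod (hyperbolicSum (n + 2))).prod
          ((-(2 * t : ℤ)) • LinearMap.mul ℤ ℤ)) r r = 2 * d ∧
        ∃ r', (((LinearMap.BilinForm.pi fun _ : Fin m ↦ -e8Form).prod (hyperbolicSum (n + 2))).prod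
          ((-(2 * t : ℤ)) • LinearMap.mul ℤ ℤ)) r r' = 1} ↦
      ∃ g : ((((LinearMap.BilinForm.pi fun _ : Fin m ↦ -e8Form).prod (hyperbolicSum (n + 2))).prod
          ((-(2 * t : ℤ)) • LinearMap.mul ℤ ℤ))).IsometryEquiv
          ((((LinearMap.BilinForm.pi fun _ : Fin m ↦ -e8Form).prod (hyperbolicSum (n + 2))).prod
          ((-(2 * t : ℤ)) • LinearMap.mul ℤ ℤ))),
        g.discriminantGroupCongr = LinearEquiv.refl ℤ _ ∧ g r.1 = s.1) = 1 := by
  obtain ⟨-, heB, huB⟩ := isSymm_isEven_isUnimodular_pi_neg_e8Form_prod_hyperbolicSum' m (n + 2)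
  exact natCard_quot_stable_isometryEquiv_two_mul_of_apply_eq_one t huB heB ht
    (twoHyperbolicPairs_pi_neg_e8Form_prod_hyperbolicSum_add_two m n) d

/-- **Example 4.10 for the models: the primitive vectors of square `2d` with `(h, L) = 2ℤ` form one `Õ`-orbit if
`d + t ≡ 0 (mod 4)` and none otherwise**, in `(E₈(−1)^{⊕m} ⊕ U^{⊕(n+2)}) ⊕ ℤ(−2t)`.
[cite: GritsenkoHulekSankaran2010Symplectic, §4 (arXiv numbering) Example 4.10] -/
theorem natCard_quot_stable_isometryEquiv_model_two_mul_of_forall_two_dvd_of_primitive (ht : 0 < t) (d : ℤ) :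
    Nat.card (Quot fun r s : {r : ((Fin m → Fin 8 → ℤ) × ((Fin (n + 2) → ℤ) × (Fin (n + 2) → ℤ))) × ℤ //
        (((LinearMap.BilinForm.pi fun _ : Fin m ↦ -e8Form).prod (hyperbolicSum (n + 2))).prod
          ((-(2 * t : ℤ)) • LinearMap.mul ℤ ℤ)) r r = 2 * d ∧ r ≠ 0 ∧
        (∀ (k : ℤ) (w : ((Fin m → Fin 8 → ℤ) × ((Fin (n + 2) → ℤ) × (Fin (n + 2) → ℤ))) × ℤ), k ≠ 0 →
          k • w ∈ ℤ ∙ r → w ∈ ℤ ∙ r) ∧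
        (∀ z, (2 : ℤ) ∣ (((LinearMap.BilinForm.pi fun _ : Fin m ↦ -e8Form).prod (hyperbolicSum (n + 2))).prod
          ((-(2 * t : ℤ)) • LinearMap.mul ℤ ℤ)) r z) ∧
        ∃ r', (((LinearMap.BilinForm.pi fun _ : Fin m ↦ -e8Form).prod (hyperbolicSum (n + 2))).prod
          ((-(2 * t : ℤ)) • LinearMap.mul ℤ ℤ)) r r' = 2} ↦
      ∃ g : ((((LinearMap.BilinForm.pi fun _ : Fin m ↦ -e8Form).prod (hyperbolicSum (n + 2))).prod
          ((-(2 * t : ℤ)) • LinearMap.mul ℤ ℤ))).IsometryEquiv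
          ((((LinearMap.BilinForm.pi fun _ : Fin m ↦ -e8Form).prod (hyperbolicSum (n + 2))).prod
          ((-(2 * t : ℤ)) • LinearMap.mul ℤ ℤ))),
        g.discriminantGroupCongr = LinearEquiv.refl ℤ _ ∧ g r.1 = s.1) = if (4 : ℤ) ∣ d + t then 1 else 0 := by
  obtain ⟨-, heB, huB⟩ := isSymm_isEven_isUnimodular_pi_neg_e8Form_prod_hyperbolicSum' m (n + 2)
  exact natCard_quot_stable_isometryEquiv_two_mul_of_forall_two_dvd_of_primitive t huB heB ht
    (twoHyperbolicPairs_pi_neg_e8Form_prod_hyperbolicSum_add_two m n) d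

/-! #### The orthogonal complements (Prop. 4.6 (iv) with `f = 1` and `f = 2`) -/

/-- Evaluation of GHS's form `B = (−2b t ∕ t −2t)`. [cite: GritsenkoHulekSankaran2010Symplectic, §4 (arXiv numbering) Prop. 4.6 (iv)] -/
theorem toBilin'_neg_twoMul_t_t_neg_twoMul_apply (b : ℤ) (p q : Fin 2 → ℤ) :
    Matrix.toBilin' !![-(2 * b), (t : ℤ); (t : ℤ), -(2 * t : ℤ)] p q =
      p 0 * (-(2 * b) * q 0 + t * q 1) + p 1 * (t * q 0 - 2 * t * q 1) := by
  rw [Matrix.toBilin'_apply]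
  simp only [Fin.sum_univ_two, Matrix.of_apply, Matrix.cons_val', Matrix.cons_val_zero, Matrix.cons_val_one,
    Matrix.empty_val', Matrix.cons_val_fin_one]
  ring

/-- **Prop. 4.6 (iv) with `f = 2`, `c = 1`, in `U ⊕ ⟨−2t⟩`: `(2e + 2bf + l_t)^⊥ = ⟨e − bf, tf + l_t⟩` has Gram matrix
`B = (−2b t ∕ t −2t)`** (determinant `4bt − t² = dt` for `4b = d + t`). [cite: GritsenkoHulekSankaran2010Symplectic, §4 (arXiv numbering) Prop. 4.6 (iv) ("`B = (−2b  c·2t/f ∕ c·2t/f  −2t)`")] -/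
theorem restrict_orthogonal_hyperbolicForm_prod_neg_twoMul_smul_mul_equivalent' (b : ℤ) :
    ((hyperbolicForm.prod ((-(2 * t : ℤ)) • LinearMap.mul ℤ ℤ)).restrict
        ((hyperbolicForm.prod ((-(2 * t : ℤ)) • LinearMap.mul ℤ ℤ)).orthogonal
          (ℤ ∙ ((![2, 2 * b] : Fin 2 → ℤ), (1 : ℤ))))).Equivalent
      (Matrix.toBilin' !![-(2 * b), (t : ℤ); (t : ℤ), -(2 * t : ℤ)]) := by
  let f : (Fin 2 → ℤ) ≃ₗ[ℤ] (hyperbolicForm.prod ((-(2 * t : ℤ)) • LinearMap.mul ℤ ℤ)).orthogonal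
      (ℤ ∙ ((![2, 2 * b] : Fin 2 → ℤ), (1 : ℤ))) :=
    { toFun := fun p ↦ ⟨(![p 0, t * p 1 - b * p 0], p 1), (mem_orthogonal_span_two_twoMul_one_iff t b _).2 (by simp)⟩
      invFun := fun w ↦ ![w.1.1 0, w.1.2]
      map_add' := fun p q ↦ by
        ext i
        · fin_cases i <;> simp
          ring
        · simp
      map_smul' := fun c p ↦ by
        ext i
        · fin_cases i <;> simp
          ring
        · simp
      left_inv := fun p ↦ by
        ext i
        fin_cases i <;> simp
      right_inv := fun w ↦ by
        have hw := (mem_orthogonal_span_two_twoMul_one_iff t b w.1).1 w.2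
        ext i
        · fin_cases i
          · simp
          · simp only [Fin.mk_one, Matrix.cons_val_one, Matrix.cons_val_zero]
            rw [hw]
        · simp }
  have hf : ∀ p, (f p : (Fin 2 → ℤ) × ℤ) = (![p 0, t * p 1 - b * p 0], p 1) := fun p ↦ rfl
  refine Equivalent.symm ⟨{ f with map_app' := fun p q ↦ ?_ }⟩
  change hyperbolicForm.prod ((-(2 * t : ℤ)) • LinearMap.mul ℤ ℤ) (f p : (Fin 2 → ℤ) × ℤ) (f q : (Fin 2 → ℤ) × ℤ) =
    Matrix.toBilin' !![-(2 * b), (t : ℤ); (t : ℤ), -(2 * t : ℤ)] p q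
  rw [hyperbolicForm_prod_neg_twoMul_smul_mul_apply, hf, hf, toBilin'_neg_twoMul_t_t_neg_twoMul_apply]
  simp only [Matrix.cons_val_zero, Matrix.cons_val_one]
  ring

/-- The split representative `e + df` of the last plane of `((E₈(−1)^{⊕m} ⊕ U^{⊕(n+1)}) ⊕ U) ⊕ ℤ(−2t)`: square `2d`,
dual vector `f`. [cite: GritsenkoHulekSankaran2010Symplectic, §4 (arXiv numbering) Example 4.8] -/
theorem splitModel_vector_one (d : ℤ) :
    ((((LinearMap.BilinForm.pi fun _ : Fin m ↦ -e8Form).prod (hyperbolicSum (n + 1))).prod hyperbolicForm).prod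
        ((-(2 * t : ℤ)) • LinearMap.mul ℤ ℤ))
          (((0 : (Fin m → Fin 8 → ℤ) × ((Fin (n + 1) → ℤ) × (Fin (n + 1) → ℤ))), ![1, d]), 0)
          (((0 : (Fin m → Fin 8 → ℤ) × ((Fin (n + 1) → ℤ) × (Fin (n + 1) → ℤ))), ![1, d]), 0) = 2 * d ∧
      ((((LinearMap.BilinForm.pi fun _ : Fin m ↦ -e8Form).prod (hyperbolicSum (n + 1))).prod hyperbolicForm).prod
        ((-(2 * t : ℤ)) • LinearMap.mul ℤ ℤ))
          (((0 : (Fin m → Fin 8 → ℤ) × ((Fin (n + 1) → ℤ) × (Fin (n + 1) → ℤ))), ![1, d]), 0)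
          (((0 : (Fin m → Fin 8 → ℤ) × ((Fin (n + 1) → ℤ) × (Fin (n + 1) → ℤ))), ![0, 1]), 0) = 1 := by
  constructor
  · simp [LinearMap.BilinForm.prod_apply, hyperbolicForm_apply]
    ring
  · simp [LinearMap.BilinForm.prod_apply, hyperbolicForm_apply]

/-- The non-split representative `2e + 2bf + l_t`: square `8b − 2t`, `(·, f) = 2`, all products even, `l_t`-coordinate
`1`. [cite: GritsenkoHulekSankaran2010Symplectic, §4 (arXiv numbering) Example 4.10] -/
theorem splitModel_vector_two (b : ℤ) :
    ((((LinearMap.BilinForm.pi fun _ : Fin m ↦ -e8Form).prod (hyperbolicSum (n + 1))).prod hyperbolicForm).prod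
        ((-(2 * t : ℤ)) • LinearMap.mul ℤ ℤ))
          (((0 : (Fin m → Fin 8 → ℤ) × ((Fin (n + 1) → ℤ) × (Fin (n + 1) → ℤ))), ![2, 2 * b]), 1)
          (((0 : (Fin m → Fin 8 → ℤ) × ((Fin (n + 1) → ℤ) × (Fin (n + 1) → ℤ))), ![2, 2 * b]), 1) =
        8 * b - 2 * t ∧
      ((((LinearMap.BilinForm.pi fun _ : Fin m ↦ -e8Form).prod (hyperbolicSum (n + 1))).prod hyperbolicForm).prod
        ((-(2 * t : ℤ)) • LinearMap.mul ℤ ℤ))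
          (((0 : (Fin m → Fin 8 → ℤ) × ((Fin (n + 1) → ℤ) × (Fin (n + 1) → ℤ))), ![2, 2 * b]), 1)
          (((0 : (Fin m → Fin 8 → ℤ) × ((Fin (n + 1) → ℤ) × (Fin (n + 1) → ℤ))), ![0, 1]), 0) = 2 ∧
      ∀ z, (2 : ℤ) ∣ ((((LinearMap.BilinForm.pi fun _ : Fin m ↦ -e8Form).prod (hyperbolicSum (n + 1))).prod
        hyperbolicForm).prod ((-(2 * t : ℤ)) • LinearMap.mul ℤ ℤ))
          (((0 : (Fin m → Fin 8 → ℤ) × ((Fin (n + 1) → ℤ) × (Fin (n + 1) → ℤ))), ![2, 2 * b]), 1) z := by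
  refine ⟨?_, ?_, fun z ↦ ?_⟩
  · simp [LinearMap.BilinForm.prod_apply, hyperbolicForm_apply]
    ring
  · simp [LinearMap.BilinForm.prod_apply, hyperbolicForm_apply]
  · simp only [LinearMap.BilinForm.prod_apply, hyperbolicForm_apply, smul_mul_apply, map_zero, LinearMap.zero_apply,
      zero_add, Matrix.cons_val_zero, Matrix.cons_val_one]
    exact ⟨z.1.2 1 + b * z.1.2 0 - t * z.2, by ring⟩

/-- **Example 4.8, the complement: "`(h_d)^⊥_{L_{2t}} ≅ L_{2t,2d} = 2U ⊕ 2E₈(−1) ⊕ ⟨−2t⟩ ⊕ ⟨−2d⟩`"** — for the model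
`(E₈(−1)^{⊕m} ⊕ U^{⊕(n+2)}) ⊕ ℤ(−2t)` (`t ≥ 1`) and a vector `h` of square `2d` with a dual vector:
`h^⊥ ≅ ((E₈(−1)^{⊕m} ⊕ U^{⊕(n+1)}) ⊕ ⟨−2d⟩) ⊕ ⟨−2t⟩`. [cite: GritsenkoHulekSankaran2010Symplectic, §4 (arXiv numbering) Example 4.8, Prop. 4.6 (iv) (`c = 0`: `B = (−2b 0 ∕ 0 −2t)`, `2b = 2d`)] -/
theorem restrict_orthogonal_model_equivalent_of_apply_eq_one (ht : 0 < t) {d : ℤ}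
    {r r' : ((Fin m → Fin 8 → ℤ) × ((Fin (n + 2) → ℤ) × (Fin (n + 2) → ℤ))) × ℤ}
    (hr : (((LinearMap.BilinForm.pi fun _ : Fin m ↦ -e8Form).prod (hyperbolicSum (n + 2))).prod
      ((-(2 * t : ℤ)) • LinearMap.mul ℤ ℤ)) r r = 2 * d)
    (hr' : (((LinearMap.BilinForm.pi fun _ : Fin m ↦ -e8Form).prod (hyperbolicSum (n + 2))).prod
      ((-(2 * t : ℤ)) • LinearMap.mul ℤ ℤ)) r r' = 1) :
    (((((LinearMap.BilinForm.pi fun _ : Fin m ↦ -e8Form).prod (hyperbolicSum (n + 2))).prod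
        ((-(2 * t : ℤ)) • LinearMap.mul ℤ ℤ)).restrict
      ((((LinearMap.BilinForm.pi fun _ : Fin m ↦ -e8Form).prod (hyperbolicSum (n + 2))).prod
        ((-(2 * t : ℤ)) • LinearMap.mul ℤ ℤ)).orthogonal (ℤ ∙ r)))).Equivalent
      ((((LinearMap.BilinForm.pi fun _ : Fin m ↦ -e8Form).prod (hyperbolicSum (n + 1))).prod
        ((-(2 * d)) • LinearMap.mul ℤ ℤ)).prod ((-(2 * t : ℤ)) • LinearMap.mul ℤ ℤ)) := by
  obtain ⟨-, heB, huB⟩ := isSymm_isEven_isUnimodular_pi_neg_e8Form_prod_hyperbolicSum' m (n + 2)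
  obtain ⟨e₁⟩ : ((LinearMap.BilinForm.pi fun _ : Fin m ↦ -e8Form).prod (hyperbolicSum (n + 2))).Equivalent
      (((LinearMap.BilinForm.pi fun _ : Fin m ↦ -e8Form).prod (hyperbolicSum (n + 1))).prod hyperbolicForm) :=
    prod_hyperbolicSum_succ_equivalent _ (n + 1)
  let φ := e₁.prodCongr (LinearMap.BilinForm.IsometryEquiv.refl ((-(2 * t : ℤ)) • LinearMap.mul ℤ ℤ))
  obtain ⟨h1, h1'⟩ := splitModel_vector_one m n t d
  set r₁ := φ.symm (((0 : (Fin m → Fin 8 → ℤ) × ((Fin (n + 1) → ℤ) × (Fin (n + 1) → ℤ))), ![1, d]), 0) with hr₁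
  have hφr₁ : φ r₁ = (((0 : (Fin m → Fin 8 → ℤ) × ((Fin (n + 1) → ℤ) × (Fin (n + 1) → ℤ))), ![1, d]), 0) :=
    φ.toLinearEquiv.apply_symm_apply _
  have hr₁r₁ : (((LinearMap.BilinForm.pi fun _ : Fin m ↦ -e8Form).prod (hyperbolicSum (n + 2))).prod
      ((-(2 * t : ℤ)) • LinearMap.mul ℤ ℤ)) r₁ r₁ = 2 * d := by
    rw [hr₁, φ.symm.map_app]
    exact h1
  obtain ⟨z, hz⟩ := (exists_apply_eq_iff_of_isometryEquiv φ.symm _ 1).2 ⟨_, h1'⟩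
  obtain ⟨g, -, hg⟩ := exists_stable_isometryEquiv_apply_eq_of_apply_eq_one_of_apply_eq_one t huB heB ht
    (twoHyperbolicPairs_pi_neg_e8Form_prod_hyperbolicSum_add_two m n) (hr.trans hr₁r₁.symm) hr' hz
  have hA := restrict_orthogonal_equivalent_of_isometryEquiv g r
  rw [hg] at hA
  have hB := restrict_orthogonal_equivalent_of_isometryEquiv φ r₁
  rw [hφr₁] at hB
  have hC := restrict_orthogonal_prod_zero_equivalent
    (((LinearMap.BilinForm.pi fun _ : Fin m ↦ -e8Form).prod (hyperbolicSum (n + 1))).prod hyperbolicForm)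
    ((-(2 * t : ℤ)) • LinearMap.mul ℤ ℤ)
    (((0 : (Fin m → Fin 8 → ℤ) × ((Fin (n + 1) → ℤ) × (Fin (n + 1) → ℤ))), ![1, d]))
  have hD := restrict_orthogonal_zero_prod_equivalent
    ((LinearMap.BilinForm.pi fun _ : Fin m ↦ -e8Form).prod (hyperbolicSum (n + 1))) hyperbolicForm
    (![1, d] : Fin 2 → ℤ)
  have hE := restrict_orthogonal_hyperbolicForm_equivalent d
  exact hA.trans (hB.trans (hC.trans ((hD.trans ((Equivalent.refl _).prod hE)).prod (Equivalent.refl _))))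

/-- **Prop. 4.6 (iv) ∕ Example 4.10, the complement for `f = 2`**: for the model `(E₈(−1)^{⊕m} ⊕ U^{⊕(n+2)}) ⊕ ℤ(−2t)`
(`t ≥ 1`), `d + t = 4b`, and a primitive `h` of square `2d` with `(h, L) = 2ℤ`:
`h^⊥ ≅ (E₈(−1)^{⊕m} ⊕ U^{⊕(n+1)}) ⊕ B`, `B = (−2b t ∕ t −2t)` (GHS's `B` with `f = 2`, `c = 1`, `b = (d + t)/4`).
For `t = 1` (`K3^{[2]}`-type) this is `L_{Q(d)}` with `Q(d) ≅ (−2 1 ∕ 1 −(d+1)/2)`.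
[cite: GritsenkoHulekSankaran2010Symplectic, §4 (arXiv numbering) Prop. 4.6 (iv), Example 4.10] [cite: GritsenkoHulekSankaran2013ModuliK3, §7 Example 7.7 ("`(h_{2d})^⊥ ≅ L_{Q(d)} = 2U ⊕ 2E₈(−1) ⊕ (−2 1 ∕ 1 −(d+1)/2)`")] -/
theorem restrict_orthogonal_model_equivalent_of_forall_two_dvd_of_primitive (ht : 0 < t) {d b : ℤ}
    (hb : d + t = 4 * b) {r : ((Fin m → Fin 8 → ℤ) × ((Fin (n + 2) → ℤ) × (Fin (n + 2) → ℤ))) × ℤ}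
    (hr : (((LinearMap.BilinForm.pi fun _ : Fin m ↦ -e8Form).prod (hyperbolicSum (n + 2))).prod
      ((-(2 * t : ℤ)) • LinearMap.mul ℤ ℤ)) r r = 2 * d) (hr0 : r ≠ 0)
    (hsat : ∀ (k : ℤ) (w : ((Fin m → Fin 8 → ℤ) × ((Fin (n + 2) → ℤ) × (Fin (n + 2) → ℤ))) × ℤ), k ≠ 0 →
      k • w ∈ ℤ ∙ r → w ∈ ℤ ∙ r)
    (h2 : ∀ z, (2 : ℤ) ∣ (((LinearMap.BilinForm.pi fun _ : Fin m ↦ -e8Form).prod (hyperbolicSum (n + 2))).prod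
      ((-(2 * t : ℤ)) • LinearMap.mul ℤ ℤ)) r z)
    (hr' : ∃ r', (((LinearMap.BilinForm.pi fun _ : Fin m ↦ -e8Form).prod (hyperbolicSum (n + 2))).prod
      ((-(2 * t : ℤ)) • LinearMap.mul ℤ ℤ)) r r' = 2) :
    (((((LinearMap.BilinForm.pi fun _ : Fin m ↦ -e8Form).prod (hyperbolicSum (n + 2))).prod
        ((-(2 * t : ℤ)) • LinearMap.mul ℤ ℤ)).restrict
      ((((LinearMap.BilinForm.pi fun _ : Fin m ↦ -e8Form).prod (hyperbolicSum (n + 2))).prod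
        ((-(2 * t : ℤ)) • LinearMap.mul ℤ ℤ)).orthogonal (ℤ ∙ r)))).Equivalent
      (((LinearMap.BilinForm.pi fun _ : Fin m ↦ -e8Form).prod (hyperbolicSum (n + 1))).prod
        (Matrix.toBilin' !![-(2 * b), (t : ℤ); (t : ℤ), -(2 * t : ℤ)])) := by
  obtain ⟨-, heB, huB⟩ := isSymm_isEven_isUnimodular_pi_neg_e8Form_prod_hyperbolicSum' m (n + 2)
  obtain ⟨e₁⟩ : ((LinearMap.BilinForm.pi fun _ : Fin m ↦ -e8Form).prod (hyperbolicSum (n + 2))).Equivalent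
      (((LinearMap.BilinForm.pi fun _ : Fin m ↦ -e8Form).prod (hyperbolicSum (n + 1))).prod hyperbolicForm) :=
    prod_hyperbolicSum_succ_equivalent _ (n + 1)
  let φ := e₁.prodCongr (LinearMap.BilinForm.IsometryEquiv.refl ((-(2 * t : ℤ)) • LinearMap.mul ℤ ℤ))
  obtain ⟨h1, h1', h1''⟩ := splitModel_vector_two m n t b
  set r₂' : (((Fin m → Fin 8 → ℤ) × ((Fin (n + 1) → ℤ) × (Fin (n + 1) → ℤ))) × (Fin 2 → ℤ)) × ℤ :=
    (((0 : (Fin m → Fin 8 → ℤ) × ((Fin (n + 1) → ℤ) × (Fin (n + 1) → ℤ))), ![2, 2 * b]), 1) with hr₂'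
  set r₂ := φ.symm r₂' with hr₂
  have hφr₂ : φ r₂ = r₂' := φ.toLinearEquiv.apply_symm_apply _
  have hr₂r₂ : (((LinearMap.BilinForm.pi fun _ : Fin m ↦ -e8Form).prod (hyperbolicSum (n + 2))).prod
      ((-(2 * t : ℤ)) • LinearMap.mul ℤ ℤ)) r₂ r₂ = 2 * d := by
    rw [hr₂, φ.symm.map_app, h1]
    linarith
  have h2r₂ := (forall_dvd_apply_iff_of_isometryEquiv φ.symm r₂' 2).2 h1''
  obtain ⟨z, hz⟩ := (exists_apply_eq_iff_of_isometryEquiv φ.symm r₂' 2).2 ⟨_, h1'⟩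
  -- `r₂'` is primitive (its `l_t`-coordinate is `1`), hence so is `r₂`
  have hr₂'sat : ∀ (k : ℤ) (w : (((Fin m → Fin 8 → ℤ) × ((Fin (n + 1) → ℤ) × (Fin (n + 1) → ℤ))) ×
      (Fin 2 → ℤ)) × ℤ), k ≠ 0 → k • w ∈ ℤ ∙ r₂' → w ∈ ℤ ∙ r₂' := by
    intro k w hk hw
    obtain ⟨a, ha⟩ := Submodule.mem_span_singleton.1 hw
    have ha2 : a = k * w.2 := by
      have := congrArg Prod.snd ha
      simp only [hr₂', Prod.smul_snd, smul_eq_mul, mul_one] at this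
      exact this
    refine Submodule.mem_span_singleton.2 ⟨w.2, ?_⟩
    have h3 : k • (w.2 • r₂' - w) = 0 := by
      rw [smul_sub, smul_smul, ← ha2, ha, sub_self]
    rw [smul_eq_zero_iff_right hk, sub_eq_zero] at h3
    exact h3
  have hr₂sat := forall_mem_span_singleton_apply_of_isometryEquiv φ.symm hr₂'sat
  have hr₂0 : r₂ ≠ 0 := by
    intro h0
    have := congrArg Prod.snd (congrArg φ h0)
    rw [hφr₂, map_zero] at this
    simp [hr₂'] at this
  obtain ⟨r', hr'⟩ := hr'
  obtain ⟨g, -, hg⟩ := exists_stable_isometryEquiv_apply_eq_of_forall_two_dvd_of_primitive t huB heB ht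
    (twoHyperbolicPairs_pi_neg_e8Form_prod_hyperbolicSum_add_two m n) hr hr₂r₂ hr0 hsat hr₂0 hr₂sat h2 h2r₂ hr' hz
  have hA := restrict_orthogonal_equivalent_of_isometryEquiv g r
  rw [hg] at hA
  have hB := restrict_orthogonal_equivalent_of_isometryEquiv φ r₂
  rw [hφr₂] at hB
  let ψ := LinearMap.BilinForm.IsometryEquiv.prodAssoc
    ((LinearMap.BilinForm.pi fun _ : Fin m ↦ -e8Form).prod (hyperbolicSum (n + 1))) hyperbolicForm
    ((-(2 * t : ℤ)) • LinearMap.mul ℤ ℤ)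
  have hB' := restrict_orthogonal_equivalent_of_isometryEquiv ψ r₂'
  have hψ : ψ r₂' = ((0 : (Fin m → Fin 8 → ℤ) × ((Fin (n + 1) → ℤ) × (Fin (n + 1) → ℤ))),
      ((![2, 2 * b] : Fin 2 → ℤ), (1 : ℤ))) := rfl
  rw [hψ] at hB'
  have hC := restrict_orthogonal_zero_prod_equivalent
    ((LinearMap.BilinForm.pi fun _ : Fin m ↦ -e8Form).prod (hyperbolicSum (n + 1)))
    (hyperbolicForm.prod ((-(2 * t : ℤ)) • LinearMap.mul ℤ ℤ)) ((![2, 2 * b] : Fin 2 → ℤ), (1 : ℤ))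
  have hD := restrict_orthogonal_hyperbolicForm_prod_neg_twoMul_smul_mul_equivalent' t b
  exact hA.trans (hB.trans (hB'.trans (hC.trans ((Equivalent.refl _).prod hD))))

end Model

end Literature.Topology.FourManifolds

end
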